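import Literature.NumberTheory.QuadraticFields.RingClassForms
import Literature.NumberTheory.NumberFields.RingClassFieldOfConductor
import Literature.NumberTheory.EllipticCurves.HuShuYin2019.SylvesterTowerFrobeniusAtThree
import Summits.BirchSwinnertonDyer.BirchSwinnertonDyer.Theorems.SylvesterTwoHeegnerIndexLevelFixingEtaStar
import HarnessLib

/-!
# The ambiguous form `η* = (243, 243m, 61m²)` of discriminant `−243m²` (`K = ℚ(√−3)`, conductor `9m`, `3 ∤ m`):
# its ideal is `(9)·𝔭_w`, so at the modulus `m` its ring class is `[𝔄_{η*}]_m = [𝔭_w]_m` (`w = (√−3)`) — the IDEAL-side reading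
# (crux `UpperOffV0HSYPlus`, stmt-BirchSwinnertonDyer-19804; route `SylvesterTwoHeegnerIndex`, rung K7t; (W2-b) route (4.2))

Cell `bsd-cm`, seat `bsd-cm-k7t-c2` g33 (PLAN Ω′ piece (III-b); planner D835 (2)/D836 (1): the pure form-side facts `η*² = 1`, `[𝔫ₙ] = η*` are w2b g0's p751406 `…LevelFixingEtaStar.lean`, imported).  Helper toward `stmt-BirchSwinnertonDyer-19804`
(`--supports … --as helper`).  THEOREMS ONLY (no definition, no named fact, no instance, no `sorry`).

WHAT.  `K ∋ ζ` with `ζ² + ζ + 1 = 0`, `[K:ℚ] = 2` (so `d_K = −3`), ring-class-order data `(b, hb, hω₀)` (integral basis `(1, b₁)`,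
`b₁² = m₀ + t₀ b₁`, `t₀² + 4m₀ = −3`) at the conductor `c = 9m`, `Δ.D = c²·(t₀² + 4m₀) = −243m²`, `2s = Δ.D − c t₀`,
`ι : O_Δ → 𝓞 K` (`ω_Δ ↦ c b₁ + s`), `w ∋ 3` the prime of `K` above `3`, and the form `η* := (243, 243m, 61m²)` (the seat memo
`W2B-RECIPROCITY-k7t-c2-g32.md` §2 (c): the class of the idèle `(√−3)_w`; the cell's representative for every parity of `m`).

* (w2b g0, p751406: `SylvesterTwoLevelFixingClassA.isPosPrim_etaStar`, `classOf'_etaStar_sq` — `η*` is primitive positive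
  definite of discriminant `Δ.D` and `[η*]² = 1`);
* `emb_omega_sub_kOf_etaStar` — `ι(ω_Δ) − k(η*) = 9m·x` with `x = b₁ − (t₀ + 27)/2`, `(2x + 27)² = −3`;
* `span_pair_eq_asIdeal_three` — `(27, m x) = 𝔭_w` (`x ∈ 𝔭_w`; conversely by unique factorisation: `(27, mx) = 𝔭_w J'` with
  `J' ≠ 𝓞_K` would force `(27, mx) ⊆ 𝔭_w² = (3)`, `3 ∣ x`, `9 ∣ 183 = −x(x + 27)` — impossible in norm);
* ★ `map_fIdeal_etaStar` — **`𝔄_{η*} = (fIdeal Δ η*).map ι = (9)·𝔭_w`**; ★ `idealClass_etaStar_eq_primeClass` — hence at the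
  modulus `m` (`3 ∤ m`): **`[𝔄_{η*}]_m = primeClass m w`** in `I_K(m)/P_{K,ℤ}(m)`.

USE (PLAN Ω′ step 4): with (III-a) `primeClass_eq_idealClass_of_classOf'_eq`, a Chebotarev prime `u₂` whose form has class
`η*` satisfies `primeClass m u₂ = primeClass m w`.

HONEST LABEL: bookkeeping in `𝓞_{ℚ(√−3)}`; no stub closed; nothing asserted on 19804; X12.CMAtTwo NOT proved; BSD is proved for
no curve.

## References
* D. A. Cox, *Primes of the form x² + ny²*, 2nd ed. (2013), §7.B Thm. 7.7, §7.C Prop. 7.20/7.22, §7.D (7.27). [Cox2013]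
* Y. Hu, J. Shu, H. Yin, Trans. AMS 372 (2019) = arXiv:1708.05266, §2.2 (the tower `H_{9p} ⊇ H_{3p} ⊇ H_p`). [HuShuYin2019]
-/

set_option autoImplicit false
-- the Summit-side namespace `Summit.BirchSwinnertonDyer.BirchSwinnertonDyer.…` (summit = problem) is mandated by D-0017
set_option linter.dupNamespace false

noncomputable section

open scoped Classical QuadraticAlgebra nonZeroDivisors NumberField

namespace Summit.BirchSwinnertonDyer.BirchSwinnertonDyer.Theorems.SylvesterTwoLevelFixingEtaStar

open Module NumberField QuadraticAlgebra Ideal IsDedekindDomain IsDedekindDomain.HeightOneSpectrum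
  Literature.Computability.Cryptography.Hallgren2005 Literature.Computability.Cryptography.Hallgren2005.OrderCl
  Literature.Computability.Cryptography.Hallgren2005.FormComposition
  Literature.NumberTheory.QuadraticFields.Quadratic Literature.NumberTheory.QuadraticFields.Quadratic.BinQF
  Literature.NumberTheory.QuadraticFields.RingClass
  Literature.NumberTheory.NumberFields Literature.NumberTheory.NumberFields.RingClassField
  Literature.NumberTheory.EllipticCurves Literature.NumberTheory.EllipticCurves.HuShuYin2019
  Summit.BirchSwinnertonDyer.BirchSwinnertonDyer.Theorems

variable {K : Type} [Field K] [NumberField K]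

/-! ## §1 The element `x = b₁ − (t₀ + 27)/2` and the ideal `(27, m x) = 𝔭_w` -/

section Ideal

variable (b : Basis (Fin 2) ℤ (𝓞 K)) (hb : b 0 = 1) {t₀ m₀ : ℤ} (hω₀ : b 1 * b 1 = (m₀ : 𝓞 K) + (t₀ : 𝓞 K) * b 1)
  (hdisc : t₀ ^ 2 + 4 * m₀ = -3)

include hdisc in
omit [NumberField K] in
/-- `t₀ + 27` is even (`t₀² + 4m₀ = −3` forces `t₀` odd). [folklore] -/
theorem two_mul_ediv_add : 2 * ((t₀ + 27) / 2) = t₀ + 27 := by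
  have hodd : t₀ % 2 = 1 := by
    have h : t₀ ^ 2 % 4 = 1 := by omega
    rcases Int.emod_two_eq_zero_or_one t₀ with h0 | h1
    · exfalso
      obtain ⟨k, hk⟩ : (2 : ℤ) ∣ t₀ := Int.dvd_of_emod_eq_zero h0
      rw [hk, show (2 * k) ^ 2 = 4 * k ^ 2 by ring, Int.mul_emod_right] at h
      exact zero_ne_one h
    · exact h1
  omega

include hω₀ hdisc in
omit [NumberField K] in
/-- **`(2x + 27)² = −3`** for `x = b₁ − (t₀ + 27)/2` (`2x + 27 = 2b₁ − t₀` and `(2b₁ − t₀)² = t₀² + 4m₀ = d_K`). [folklore] -/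
theorem sq_two_mul_x_add : (2 * (b 1 - (((t₀ + 27) / 2 : ℤ) : 𝓞 K)) + 27) ^ 2 = -3 := by
  have hT := two_mul_ediv_add hdisc
  have h2x : 2 * (b 1 - (((t₀ + 27) / 2 : ℤ) : 𝓞 K)) + 27 = 2 * b 1 - (t₀ : 𝓞 K) := by
    have : (2 : 𝓞 K) * (((t₀ + 27) / 2 : ℤ) : 𝓞 K) = (t₀ : 𝓞 K) + 27 := by exact_mod_cast congrArg (Int.cast : ℤ → 𝓞 K) hT
    linear_combination -this
  rw [h2x]
  have hd : ((t₀ ^ 2 + 4 * m₀ : ℤ) : 𝓞 K) = ((-3 : ℤ) : 𝓞 K) := by rw [hdisc]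
  push_cast at hd
  linear_combination 4 * hω₀ + hd

include hω₀ hdisc in
/-- `x² + 27x + 183 = 0` (the minimal polynomial of `(−27 + √−3)/2`). [folklore] -/
theorem x_sq_add : (b 1 - (((t₀ + 27) / 2 : ℤ) : 𝓞 K)) ^ 2 + 27 * (b 1 - (((t₀ + 27) / 2 : ℤ) : 𝓞 K)) + 183 = 0 := by
  have h := sq_two_mul_x_add b hω₀ hdisc
  have h4 : (4 : 𝓞 K) * ((b 1 - (((t₀ + 27) / 2 : ℤ) : 𝓞 K)) ^ 2 + 27 * (b 1 - (((t₀ + 27) / 2 : ℤ) : 𝓞 K)) + 183) = 0 := by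
    linear_combination h
  have h4ne : (4 : 𝓞 K) ≠ 0 := by norm_num
  rcases mul_eq_zero.mp h4 with h0 | h0
  · exact absurd h0 h4ne
  · exact h0

variable {ζ : K} (hζ : ζ ^ 2 + ζ + 1 = 0) (h2 : finrank ℚ K = 2)
  (w : HeightOneSpectrum (𝓞 K)) (h3w : ((3 : ℕ) : 𝓞 K) ∈ w.asIdeal)

include hω₀ hdisc h3w in
omit [NumberField K] in
/-- **`x ∈ 𝔭_w`**: `(2x + 27)² = −3 ∈ 𝔭_w`, so `2x + 27 ∈ 𝔭_w`, `2x ∈ 𝔭_w`, and `2 ∉ 𝔭_w`. [folklore] -/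
theorem x_mem_asIdeal : b 1 - (((t₀ + 27) / 2 : ℤ) : 𝓞 K) ∈ w.asIdeal := by
  set x := b 1 - (((t₀ + 27) / 2 : ℤ) : 𝓞 K) with hx
  have h3 : (3 : 𝓞 K) ∈ w.asIdeal := by exact_mod_cast h3w
  have hsq : (2 * x + 27) ^ 2 ∈ w.asIdeal := by
    rw [sq_two_mul_x_add b hω₀ hdisc, show (-3 : 𝓞 K) = -1 * 3 by ring]
    exact Ideal.mul_mem_left _ _ h3
  have h1 : 2 * x + 27 ∈ w.asIdeal := w.isPrime.mem_of_pow_mem 2 hsq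
  have h27 : (27 : 𝓞 K) ∈ w.asIdeal := by
    rw [show (27 : 𝓞 K) = 9 * 3 by norm_num]; exact Ideal.mul_mem_left _ _ h3
  have h2x : 2 * x ∈ w.asIdeal := by
    have := Ideal.sub_mem _ h1 h27; rwa [add_sub_cancel_right] at this
  rcases w.isPrime.mem_or_mem h2x with h | h
  · exfalso
    have : (1 : 𝓞 K) ∈ w.asIdeal := by
      have := Ideal.sub_mem _ h3 h; rwa [show (3 : 𝓞 K) - 2 = 1 by norm_num] at this
    exact w.isPrime.ne_top ((Ideal.eq_top_iff_one _).mpr this)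
  · exact h

include hb hω₀ hdisc hζ h2 h3w in
/-- **`(27, m x) = 𝔭_w`** for `3 ∤ m`.  `⊆`: both generators lie in `𝔭_w`.  `⊇`: write `(27, mx) = 𝔭_w · J'`; if `J' ≠ 𝓞_K`, a
maximal `𝔪 ⊇ J'` contains `27`, hence `3`, hence `𝔭_w² = (3)`, so `𝔪 = 𝔭_w` and `(27, mx) ⊆ 𝔭_w² = (3)`; then `3 ∣ x`
(`gcd(3, m) = 1`) and `x(x + 27) = −183` gives `9 ∣ 183` in `𝓞_K`, contradicting `N(183) = 183²`, `81 ∤ 183²`.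
[cite: Cox2013, §5.B (unique factorisation of ideals) and §7.B Thm. 7.7] -/
theorem span_pair_eq_asIdeal_three {m : ℕ} (hm3 : ¬ 3 ∣ m) :
    Ideal.span {(27 : 𝓞 K), (m : 𝓞 K) * (b 1 - (((t₀ + 27) / 2 : ℤ) : 𝓞 K))} = w.asIdeal := by
  set x := b 1 - (((t₀ + 27) / 2 : ℤ) : 𝓞 K) with hx
  have h3 : (3 : 𝓞 K) ∈ w.asIdeal := by exact_mod_cast h3w
  have h27 : (27 : 𝓞 K) ∈ w.asIdeal := by
    rw [show (27 : 𝓞 K) = 9 * 3 by norm_num]; exact Ideal.mul_mem_left _ _ h3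
  have hxw : x ∈ w.asIdeal := x_mem_asIdeal b hω₀ hdisc w h3w
  set J : Ideal (𝓞 K) := Ideal.span {(27 : 𝓞 K), (m : 𝓞 K) * x} with hJ
  have hJw : J ≤ w.asIdeal := by
    rw [hJ, Ideal.span_le]
    rintro y hy
    simp only [Set.mem_insert_iff, Set.mem_singleton_iff] at hy
    rcases hy with rfl | rfl
    · exact h27
    · exact Ideal.mul_mem_left _ _ hxw
  -- `(3) = 𝔭_w²`, `𝔭_w` maximal
  have hsq : (Ideal.span {((3 : ℕ) : 𝓞 K)} : Ideal (𝓞 K)) = w.asIdeal ^ 2 := JZero.span_three_eq_asIdeal_sq hζ h2 w h3w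
  have hwmax : w.asIdeal.IsMaximal := w.isPrime.isMaximal w.ne_bot
  -- `J = 𝔭_w · J'`
  obtain ⟨J', hJ'⟩ := Ideal.dvd_iff_le.mpr hJw
  by_cases hJ'top : J' = ⊤
  · rw [hJ', hJ'top, Ideal.mul_top]
  exfalso
  obtain ⟨M, hMmax, hJ'M⟩ := Ideal.exists_le_maximal J' hJ'top
  have hJM : J ≤ M := hJ'.le.trans (Ideal.mul_le_left.trans hJ'M)
  have h27M : (27 : 𝓞 K) ∈ M := hJM (Ideal.subset_span (by simp))
  have h3M : (3 : 𝓞 K) ∈ M := by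
    have : (3 : 𝓞 K) ^ 3 ∈ M := by rw [show (3 : 𝓞 K) ^ 3 = 27 by norm_num]; exact h27M
    exact hMmax.isPrime.mem_of_pow_mem 3 this
  have hwM : w.asIdeal ≤ M := by
    intro y hy
    have hy2 : y ^ 2 ∈ w.asIdeal ^ 2 := Ideal.pow_mem_pow hy 2
    rw [← hsq, Ideal.mem_span_singleton] at hy2
    have hy2M : y ^ 2 ∈ M := by
      obtain ⟨z, hz⟩ := hy2; rw [hz]; push_cast; exact Ideal.mul_mem_right _ _ h3M
    exact hMmax.isPrime.mem_of_pow_mem 2 hy2M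
  have hMw : M = w.asIdeal := (hwmax.eq_of_le hMmax.ne_top hwM).symm
  -- hence `J ≤ 𝔭_w² = (3)`, so `3 ∣ m x`, so `3 ∣ x`
  have hJ3 : J ≤ Ideal.span {((3 : ℕ) : 𝓞 K)} := by
    rw [hsq, sq, hJ']
    exact Ideal.mul_mono_right (hJ'M.trans hMw.le)
  have hmx : (m : 𝓞 K) * x ∈ Ideal.span {((3 : ℕ) : 𝓞 K)} := hJ3 (Ideal.subset_span (by simp))
  rw [Ideal.mem_span_singleton] at hmx
  have h3x : (3 : 𝓞 K) ∣ x := by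
    have hcop : IsCoprime (3 : ℤ) (m : ℤ) := by
      rw [Prime.coprime_iff_not_dvd Int.prime_three]; exact_mod_cast hm3
    obtain ⟨u, v, huv⟩ := hcop
    have hx1 : x = (u : 𝓞 K) * (3 * x) + (v : 𝓞 K) * ((m : 𝓞 K) * x) := by
      have h1 : ((u * 3 + v * m : ℤ) : 𝓞 K) = 1 := by rw [huv]; push_cast; rfl
      push_cast at h1
      linear_combination -x * h1
    rw [hx1]
    exact dvd_add (dvd_mul_of_dvd_right (dvd_mul_right 3 x) _) (dvd_mul_of_dvd_right (by exact_mod_cast hmx) _)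
  obtain ⟨y, hy⟩ := h3x
  -- `x(x + 27) = -183`, so `9 ∣ 183` in `𝓞 K`
  have hrel := x_sq_add b hω₀ hdisc
  rw [← hx] at hrel
  have h183 : (183 : 𝓞 K) = 9 * (-(y ^ 2) - 9 * y) := by
    rw [hy] at hrel; linear_combination hrel
  -- norms: `N(183) = 183²`, `N(9 z) = 81 N(z)`
  have hr : finrank ℤ (𝓞 K) = 2 := by simpa using finrank_eq_card_basis b
  have hN := congrArg (Algebra.norm ℤ) h183
  rw [map_mul, show (183 : 𝓞 K) = algebraMap ℤ (𝓞 K) 183 by simp, show (9 : 𝓞 K) = algebraMap ℤ (𝓞 K) 9 by simp,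
    Algebra.norm_algebraMap, Algebra.norm_algebraMap, hr] at hN
  have _ := hb
  omega

include hb hω₀ hdisc hζ h2 h3w in
/-- `(243, 9m·x) = (9)·𝔭_w`. [cite: Cox2013, §7.B Thm. 7.7] -/
theorem span_pair_eq_span_nine_mul {m : ℕ} (hm3 : ¬ 3 ∣ m) :
    Ideal.span {(243 : 𝓞 K), (9 * m : 𝓞 K) * (b 1 - (((t₀ + 27) / 2 : ℤ) : 𝓞 K))} =
      Ideal.span {(9 : 𝓞 K)} * w.asIdeal := by
  rw [← span_pair_eq_asIdeal_three b hb hω₀ hdisc hζ h2 w h3w hm3, OrderCl.span_singleton_mul_span_pair]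
  congr 1
  ext y
  simp only [Set.mem_insert_iff, Set.mem_singleton_iff]
  constructor
  · rintro (rfl | rfl)
    · left; norm_num
    · right; ring
  · rintro (rfl | rfl)
    · left; norm_num
    · right; ring

end Ideal

/-! ## §2 ★ `𝔄_{η*} = (9)·𝔭_w` and `[𝔄_{η*}]_m = primeClass m w` -/

section Class

variable (b : Basis (Fin 2) ℤ (𝓞 K)) (hb : b 0 = 1) {t₀ m₀ : ℤ} (hω₀ : b 1 * b 1 = (m₀ : 𝓞 K) + (t₀ : 𝓞 K) * b 1)
  (hdisc : t₀ ^ 2 + 4 * m₀ = -3)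
  {c m : ℕ} (hcm : c = 9 * m) (hm3 : ¬ 3 ∣ m) (Δ : NegDiscr) {s : ℤ}
  (hD : Δ.D = (c : ℤ) ^ 2 * (t₀ ^ 2 + 4 * m₀)) (hs : 2 * s = Δ.D - c * t₀)
  (ι : QO Δ →+* 𝓞 K) (hι : ι ω = (c : 𝓞 K) * b 1 + (s : 𝓞 K))
  {ζ : K} (hζ : ζ ^ 2 + ζ + 1 = 0) (h2 : finrank ℚ K = 2)
  (w : HeightOneSpectrum (𝓞 K)) (h3w : ((3 : ℕ) : 𝓞 K) ∈ w.asIdeal)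

include hdisc hcm hD in
omit [NumberField K] in
/-- `Δ.D = (9m)²·(−3)`. [folklore] -/
theorem discr_eq : Δ.D = ((9 * m : ℕ) : ℤ) ^ 2 * (-3) := by rw [hD, hdisc, hcm]

include hdisc hcm hm3 hD hs hι in
omit [NumberField K] in
/-- **`ι(ω_Δ) − k(η*) = 9m · x`**, `x = b₁ − (t₀ + 27)/2` (`2k(η*) = 243m + Δ.D`, `2s = Δ.D − 9m t₀`). [cite: Cox2013, §7.B Thm. 7.7] -/
theorem emb_omega_sub_kOf_etaStar :
    ι ω - ((kOf Δ.D ⟨243, 243 * (m : ℤ), 61 * (m : ℤ) ^ 2⟩ : ℤ) : 𝓞 K) =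
      (9 * m : 𝓞 K) * (b 1 - (((t₀ + 27) / 2 : ℤ) : 𝓞 K)) := by
  have hΔ := discr_eq hdisc hcm Δ hD
  have hq := (SylvesterTwoLevelFixingClassA.isPosPrim_etaStar Δ hm3 hΔ).disc_eq
  have hk := two_mul_kOf hq
  dsimp only at hk
  have hT := two_mul_ediv_add hdisc
  subst hcm
  set k : ℤ := kOf Δ.D ⟨243, 243 * (m : ℤ), 61 * (m : ℤ) ^ 2⟩ with hkdef
  set T : ℤ := (t₀ + 27) / 2 with hTdef
  -- `s - k = -9mT` as integers (`2s = D − 9m t₀`, `2k = 243m + D`, `2T = t₀ + 27`)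
  have hs' : 2 * s = Δ.D - ((9 * m : ℕ) : ℤ) * t₀ := hs
  push_cast at hs'
  have hsk : s - k = -(9 * (m : ℤ) * T) := by
    have h2 : 2 * (s - k) = 2 * (-(9 * (m : ℤ) * T)) := by linear_combination hs' - hk + 9 * (m : ℤ) * hT
    exact mul_left_cancel₀ two_ne_zero h2
  rw [hι]
  have hskK : (s : 𝓞 K) - (k : 𝓞 K) = -(9 * (m : 𝓞 K) * (T : 𝓞 K)) := by exact_mod_cast congrArg (Int.cast : ℤ → 𝓞 K) hsk
  push_cast
  linear_combination hskK

include hb hω₀ hdisc hcm hm3 hD hs hι hζ h2 h3w in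
/-- ★ **`𝔄_{η*} = (9)·𝔭_w`**: the ideal of `𝓞_K` under the form `η* = (243, 243m, 61m²)` of the order of conductor `9m` is
`(243, 9m x) = (9)(27, m x) = (9)·𝔭_w`. [cite: Cox2013, §7.B Thm. 7.7 and §7.C Prop. 7.20] -/
theorem map_fIdeal_etaStar :
    (fIdeal Δ ⟨243, 243 * (m : ℤ), 61 * (m : ℤ) ^ 2⟩).map ι = Ideal.span {(9 : 𝓞 K)} * w.asIdeal := by
  rw [fIdeal, Ideal.map_span, Set.image_pair, map_sub, map_intCast, map_intCast,
    emb_omega_sub_kOf_etaStar b hdisc hcm hm3 Δ hD hs ι hι]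
  dsimp only
  rw [show (((243 : ℤ) : ℤ) : 𝓞 K) = (243 : 𝓞 K) by norm_num]
  exact span_pair_eq_span_nine_mul b hb hω₀ hdisc hζ h2 w h3w hm3

include hb hω₀ hdisc hcm hm3 hD hs hι hζ h2 h3w in
/-- ★ **`[𝔄_{η*}]_m = primeClass m w`** in `I_K(m)/P_{K,ℤ}(m)` (`3 ∤ m`, so `𝔭_w ∤ m` and `(9) ∈ P_{K,ℤ}(m)`).
[cite: Cox2013, §7.C Prop. 7.22 and §7.D (7.27)] -/
theorem idealClass_etaStar_eq_primeClass
    (h0 : (fIdeal Δ ⟨243, 243 * (m : ℤ), 61 * (m : ℤ) ^ 2⟩).map ι ≠ ⊥)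
    (hcop : (fIdeal Δ ⟨243, 243 * (m : ℤ), 61 * (m : ℤ) ^ 2⟩).map ι ⊔ Ideal.span {(m : 𝓞 K)} = ⊤) :
    idealClass m h0 hcop = primeClass m w := by
  have hI := map_fIdeal_etaStar b hb hω₀ hdisc hcm hm3 Δ hD hs ι hι hζ h2 w h3w
  have hwm : ¬ Ideal.span {(m : 𝓞 K)} ≤ w.asIdeal := JZero.not_span_natCast_le_of_not_three_dvd w h3w hm3
  have hwcop : w.asIdeal ⊔ Ideal.span {(m : 𝓞 K)} = ⊤ := (sup_span_eq_top_iff_not_le m).mpr hwm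
  rw [primeClass_of_sup_eq_top m hwcop, idealClass_eq, idealClass_eq, QuotientGroup.eq, Subgroup.mem_subgroupOf]
  have h9 : (9 : 𝓞 K) ≠ 0 := by norm_num
  have h9cop : IsCoprime (9 : ℤ) (m : ℤ) := by
    rw [show (9 : ℤ) = 3 ^ 2 by norm_num]
    refine IsCoprime.pow_left ?_
    rw [Prime.coprime_iff_not_dvd Int.prime_three]; exact_mod_cast hm3
  set UI := FractionalIdeal.mk0 K ⟨(fIdeal Δ ⟨243, 243 * (m : ℤ), 61 * (m : ℤ) ^ 2⟩).map ι,
    mem_nonZeroDivisors_of_ne_bot h0⟩ with hUI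
  set Uw := FractionalIdeal.mk0 K ⟨w.asIdeal, mem_nonZeroDivisors_of_ne_bot w.ne_bot⟩ with hUw
  have hunits : UI = prin K (9 : 𝓞 K) h9 * Uw := by
    apply Units.ext
    simp only [Units.val_mul, coe_prin', FractionalIdeal.coe_mk0, hUI, hUw]
    rw [← FractionalIdeal.coeIdeal_mul, ← hI]
  show UI⁻¹ * Uw ∈ ringClassDen K m
  rw [hunits, mul_inv_rev, mul_comm Uw⁻¹ _, inv_mul_cancel_right]
  exact Subgroup.inv_mem _ (prin_mem_ringClassDen h9 h9cop (by
    rw [show (9 : 𝓞 K) - ((9 : ℤ) : 𝓞 K) = 0 by norm_num]; exact Submodule.zero_mem _))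

end Class

end Summit.BirchSwinnertonDyer.BirchSwinnertonDyer.Theorems.SylvesterTwoLevelFixingEtaStar

end
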